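import Summits.BirchSwinnertonDyer.Rank1Residual.X11b.HeegnerHeckeNeighbours
import HarnessLib

/-!
# The `ℓ + 1` Hecke neighbours of a Heegner form are pairwise `Γ₀(N)`-inequivalent (`D < −4`)

Team x11b3 (N8/O2), `h37` PIECE 1, part (c) (companion of
`X11b/HeegnerHeckeNeighbours.lean`; x11b3-p7 `H37-SCOPE.md` (β2-b)(i)(c); lead GEN 8 deal
R9-9).  Summit-side THEOREM-ONLY file (no definition, no named fact, no `sorry`), `p`-free.
HONEST FRAMING (H47): plumbing toward Gross 1991, Prop. 3.7 (1) only ("`Tr_ℓ x_n = T_ℓ(x_m)` as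
an equality of divisors of degree `ℓ + 1`" [Gross 1991, §3, p. 217] needs the `ℓ + 1` points of
`T_ℓ(x_m)` to be DISTINCT points of `X₀(N)`); it discharges neither `h37` nor `h44`; the labelled
set of the `h44` programme stays `{h37}`; nothing is `p = 3`-specific; nothing is booked; no
mark / label / count moves.

## What is proved

For a Heegner form `Q = (A, B, C) ∈ heegnerForms N D` with `D < −4` (Gross 1991, §1, p. 212:
"we assume that `D ≠ 3, 4`, so ... `𝒪^× = ⟨±1⟩`" — for `D ∈ {−3, −4}` the statement is false:
the extra units identify the neighbours in orbits of size `3`, `2`), a prime `ℓ` inert for `D`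
(`∀ x, 4ℓ ∤ x² − D`) and the neighbour forms `Q_j = (A ℓ², ℓ(B − 2Aj), A j² − B j + C)`,
`Q_∞ = (A, ℓB, ℓ²C)` of `HeegnerHeckeNeighbours`:

* `sl2_smul_heegnerTau_translate_ne_translate` — `g • τ_{Q_j} ≠ τ_{Q_k}` for every
  `g ∈ SL₂(ℤ)` when `ℓ ∤ j − k`;
* `sl2_smul_heegnerTau_translate_ne_scale` — `g • τ_{Q_j} ≠ τ_{Q_∞}` for every `g ∈ SL₂(ℤ)`;
* `not_isGamma0Equiv_translate_translate`, `not_isGamma0Equiv_translate_scale`,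
  `not_isGamma0Equiv_scale_translate` — a fortiori the `ℓ + 1` forms are pairwise
  `Γ₀(N)`-inequivalent (`IsGamma0Equiv N`), i.e. define `ℓ + 1` distinct points of `Y₀(N)`;
  and `isGamma0Equiv_translate_translate_add` — `Q_j ∼ Q_{j+ℓ}` (`T ∈ Γ₀(N)`), so these are
  ALL the classes of translates (no `D < −4` needed for this direction).

Proof (lattice-free).  `g • τ_{Q_j} = τ_{Q_k}` with `τ_{Q_j} = (τ_Q + j)/ℓ`, `τ_{Q_k} = (τ_Q + k)/ℓ`
gives an integral relation `p τ_Q + q = τ_Q (r τ_Q + s)` with `ps − qr = ℓ²`; since `τ_Q ∉ ℝ`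
and `Q` is primitive, `(r, s − p, −q) = t (A, B, C)` (`exists_eq_mul_of_moebius_fix`), and then
`p (p + tB) + t² AC = ℓ²`.  If `ℓ ∤ t` the congruences force `ℓ ∣ C_j` (resp. `ℓ ∣ A` in the
`Q_∞` case), excluded by inertness (`not_dvd_third_of_inert`, `not_dvd_fst_of_inert`); so
`t = ℓ t₁`, `p = ℓ p₁` and `(2p₁ + t₁B)² − t₁² D = 4`, whence `t₁ = 0` as `−D > 4`
(`eq_zero_of_norm_eq_one`); `t = 0` makes `g = ±(1 (k − j)/ℓ; 0 1)`, integral only if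
`ℓ ∣ j − k` (resp. `g = ±(ℓ −j; 0 1/ℓ)`, never integral).

## References

* B. H. Gross, *Kolyvagin's work on modular elliptic curves*, in *L-functions and Arithmetic*,
  LMS LNS 153 (1991), §1 (p. 212, `𝒪^× = ⟨±1⟩`) and §3, proof of Prop. 3.7 (p. 217).
  [GrossLMS1991]
* B. H. Gross, *Heegner points on X₀(N)* (1984), §6. [Gross1984]

## Mathlib / tree search

Tree: `heegnerTau_isRoot`, `sl2z_denom_ne_zero` (`HeegnerPoints*`), `coe_tpB_smul`,
`coe_tpD_smul` (`HeckeOperatorsProofs`), `IsGamma0Equiv` (`HeegnerPoints`), and part (a)(b)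
`HeegnerHecke.heegnerTau_translate`, `heegnerTau_scale`, `not_dvd_third_of_inert`,
`not_dvd_fst_of_inert` (`X11b/HeegnerHeckeNeighbours`).  Mathlib:
`UpperHalfPlane.coe_specialLinearGroup_apply`, `Int.gcd_eq_gcd_ab`, `Matrix.det_fin_two`.
-/

open UpperHalfPlane
open scoped MatrixGroups

namespace Summit.BirchSwinnertonDyer.Rank1Residual.X11b.HeegnerHecke

open Literature.NumberTheory.EllipticCurves
open Literature.NumberTheory.EllipticCurves.ModularForms

variable {N : ℕ} {D A B C : ℤ} {ℓ : ℕ}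

/-! ### Integral Möbius relations at `τ_Q` are multiples of `Q` -/

/-- `gcd(A, B, C) = 1` in Bézout form. [folklore] -/
theorem exists_bezout_three (hprim : ∀ d : ℤ, d ∣ A → d ∣ B → d ∣ C → IsUnit d) :
    ∃ u v w : ℤ, u * A + v * B + w * C = 1 := by
  set g₁ : ℕ := Int.gcd B C with hg₁
  set g : ℕ := Int.gcd A g₁ with hg
  have hgA : (g : ℤ) ∣ A := Int.gcd_dvd_left ..
  have hg1 : (g : ℤ) ∣ (g₁ : ℤ) := Int.gcd_dvd_right ..
  have hgB : (g : ℤ) ∣ B := hg1.trans (Int.gcd_dvd_left ..)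
  have hgC : (g : ℤ) ∣ C := hg1.trans (Int.gcd_dvd_right ..)
  have hg_one : (g : ℤ) = 1 := by
    have h := Int.isUnit_iff_natAbs_eq.mp (hprim g hgA hgB hgC)
    rw [Int.natAbs_natCast] at h
    exact_mod_cast h
  refine ⟨Int.gcdA A g₁, Int.gcdB A g₁ * Int.gcdA B C, Int.gcdB A g₁ * Int.gcdB B C, ?_⟩
  have h1 : ((g₁ : ℕ) : ℤ) = B * Int.gcdA B C + C * Int.gcdB B C := Int.gcd_eq_gcd_ab B C
  have h2 : ((g : ℕ) : ℤ) = A * Int.gcdA A g₁ + g₁ * Int.gcdB A g₁ := Int.gcd_eq_gcd_ab A g₁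
  rw [hg_one] at h2
  linear_combination -h2 - Int.gcdB A ↑g₁ * h1

/-- **An integral Möbius relation `p τ_Q + q = τ_Q (r τ_Q + s)` at the Heegner point of a
PRIMITIVE positive definite form `Q = (A, B, C)` is a multiple of `Q`:** `r = tA`, `s − p = tB`,
`q = −tC` for some `t ∈ ℤ` (`r τ² + (s − p) τ − q = 0` and `A τ² + B τ + C = 0` with `τ ∉ ℝ` give
`A (s − p) = r B`, `A q = −r C`, and `gcd(A, B, C) = 1` gives `A ∣ r`).  Equivalently, the
integral matrices fixing `τ_Q` are `p·1 + t·(0 −C; A B)` (the order of discriminant `B² − 4AC`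
acting on its lattice `ℤ + ℤτ_Q`). [folklore] -/
theorem exists_eq_mul_of_moebius_fix (hA : 0 < A) (hD : B ^ 2 - 4 * A * C < 0)
    (hprim : ∀ d : ℤ, d ∣ A → d ∣ B → d ∣ C → IsUnit d) {p q r s : ℤ}
    (h : (p : ℂ) * heegnerTau (A, B, C) + q =
      heegnerTau (A, B, C) * (r * heegnerTau (A, B, C) + s)) :
    ∃ t : ℤ, r = t * A ∧ s - p = t * B ∧ q = -(t * C) := by
  set τ : ℂ := (heegnerTau (A, B, C) : ℂ) with hτ
  have hroot : (A : ℂ) * τ ^ 2 + B * τ + C = 0 := heegnerTau_isRoot (Q := (A, B, C)) hA hD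
  -- eliminate `τ²`: `(A (s - p) - r B) τ = A q + r C`
  have hlin : ((A * (s - p) - r * B : ℤ) : ℂ) * τ = ((A * q + r * C : ℤ) : ℂ) := by
    push_cast
    linear_combination (-(A : ℂ)) * h - (r : ℂ) * hroot
  have him : τ.im ≠ 0 := by
    rw [hτ, UpperHalfPlane.coe_im]
    exact (heegnerTau (A, B, C)).im_pos.ne'
  have h1 : A * (s - p) - r * B = 0 := by
    have h' := congrArg Complex.im hlin
    simp only [Complex.mul_im, Complex.intCast_re, Complex.intCast_im, zero_mul, add_zero] at h'
    exact_mod_cast (mul_eq_zero.mp h').resolve_right him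
  have h2 : A * q + r * C = 0 := by
    rw [h1, Int.cast_zero, zero_mul] at hlin
    exact_mod_cast hlin.symm
  obtain ⟨u, v, w, hbez⟩ := exists_bezout_three hprim
  refine ⟨r * u + (s - p) * v - q * w, ?_, ?_, ?_⟩
  · linear_combination (-(r : ℤ)) * hbez - v * h1 + w * h2
  · have hA0 : A ≠ 0 := hA.ne'
    have : A * (s - p) = A * ((r * u + (s - p) * v - q * w) * B) := by
      linear_combination (w * C + u * A) * h1 + w * B * h2 - A * (s - p) * hbez
    exact mul_left_cancel₀ hA0 this
  · have hA0 : A ≠ 0 := hA.ne'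
    have : A * q = A * (-((r * u + (s - p) * v - q * w) * C)) := by
      linear_combination (1 - w * C) * h2 + r * C * hbez + v * C * h1
    exact mul_left_cancel₀ hA0 this

/-- `p₁ (p₁ + t₁ B) + t₁² A C = 1` forces `t₁ = 0` when `B² − 4AC < −4`: multiplying by `4`,
`(2p₁ + t₁B)² − t₁² (B² − 4AC) = 4` (the elements of norm `1` in an imaginary quadratic order of
discriminant `< −4` are `±1`; Gross 1991, §1: `𝒪^× = ⟨±1⟩` for `D ≠ −3, −4`).
[cite: GrossLMS1991, §1 (unit group ±1)] -/
theorem eq_zero_of_norm_eq_one (hD4 : B ^ 2 - 4 * A * C < -4) {p₁ t₁ : ℤ}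
    (h : p₁ * (p₁ + t₁ * B) + t₁ ^ 2 * A * C = 1) : t₁ = 0 := by
  by_contra ht
  have ht1 : 1 ≤ t₁ ^ 2 := by
    have := Int.one_le_abs ht
    nlinarith [abs_nonneg t₁, sq_abs t₁]
  have h4 : (2 * p₁ + t₁ * B) ^ 2 = 4 + t₁ ^ 2 * (B ^ 2 - 4 * A * C) := by
    linear_combination 4 * h
  nlinarith [sq_nonneg (2 * p₁ + t₁ * B), mul_le_mul_of_nonneg_left ht1 (by norm_num : (0:ℤ) ≤ 4)]

/-! ### `g • τ_{Q_j} ≠ τ_{Q_k}` (`ℓ ∤ j − k`) and `g • τ_{Q_j} ≠ τ_{Q_∞}` for `g ∈ SL₂(ℤ)` -/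

/-- **Distinct translates are `SL₂(ℤ)`-inequivalent:** for a Heegner form `(A, B, C)` of
discriminant `D < −4`, a prime `ℓ` inert for `D` and `ℓ ∤ j − k`, no `g ∈ SL₂(ℤ)` maps
`τ_{Q_j} = (τ_Q + j)/ℓ` to `τ_{Q_k} = (τ_Q + k)/ℓ` (the index-`ℓ` sublattices
`ℤℓ + ℤ(τ_Q + j) ≠ ℤℓ + ℤ(τ_Q + k)` of `ℤ + ℤτ_Q` are not homothetic: a homothety would be a unit
of `𝒪_K`, i.e. `±1`). [cite: GrossLMS1991, §3 Prop. 3.7 (proof)] -/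
theorem sl2_smul_heegnerTau_translate_ne_translate (hQ : (A, B, C) ∈ heegnerForms N D)
    (hD4 : D < -4) (hℓ : ℓ.Prime) (hin : ∀ x : ℤ, ¬ (4 * (ℓ : ℤ) ∣ x ^ 2 - D)) {j k : ℤ}
    (hjk : ¬ ((ℓ : ℤ) ∣ j - k)) (g : SL(2, ℤ)) :
    g • heegnerTau (A * (ℓ : ℤ) ^ 2, (ℓ : ℤ) * (B - 2 * A * j), A * j ^ 2 - B * j + C) ≠
      heegnerTau (A * (ℓ : ℤ) ^ 2, (ℓ : ℤ) * (B - 2 * A * k), A * k ^ 2 - B * k + C) := by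
  simp only [heegnerForms, Set.mem_setOf_eq] at hQ
  obtain ⟨hdisc, hA, -, hprim⟩ := hQ
  have hD : B ^ 2 - 4 * A * C < 0 := by linarith
  have hℓp : Prime (ℓ : ℤ) := Int.prime_iff_natAbs_prime.mpr (by simpa using hℓ)
  haveI : NeZero ℓ := ⟨hℓ.ne_zero⟩
  intro hg
  rw [heegnerTau_translate hA hD j, heegnerTau_translate hA hD k] at hg
  -- coordinates
  set a : ℤ := g 0 0 with ha
  set b : ℤ := g 0 1 with hb
  set c : ℤ := g 1 0 with hc
  set d : ℤ := g 1 1 with hd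
  have hdet : a * d - b * c = 1 := by
    have h := Matrix.det_fin_two (g : Matrix (Fin 2) (Fin 2) ℤ)
    rw [g.det_coe] at h
    exact h.symm
  set τ : ℂ := (heegnerTau (A, B, C) : ℂ) with hτ
  set zj : ℂ := ((tpB ℓ j • heegnerTau (A, B, C) : ℍ) : ℂ) with hzj
  set zk : ℂ := ((tpB ℓ k • heegnerTau (A, B, C) : ℍ) : ℂ) with hzk
  have hℓC : (ℓ : ℂ) ≠ 0 := by exact_mod_cast hℓ.ne_zero
  have hzj' : (ℓ : ℂ) * zj = τ + j := by rw [hzj, coe_tpB_smul, ← hτ]; field_simp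
  have hzk' : (ℓ : ℂ) * zk = τ + k := by rw [hzk, coe_tpB_smul, ← hτ]; field_simp
  have hden : (c : ℂ) * zj + d ≠ 0 := sl2z_denom_ne_zero g _
  have hg' : (a : ℂ) * zj + b = zk * ((c : ℂ) * zj + d) := by
    have h := congrArg (fun z : ℍ ↦ (z : ℂ)) hg
    simp only [coe_specialLinearGroup_apply, eq_intCast, Complex.ofReal_intCast] at h
    rw [← hzk, div_eq_iff hden] at h
    exact h
  -- the integral relation `p τ + q = τ (r τ + s)`
  have key : ((ℓ * a - k * c : ℤ) : ℂ) * heegnerTau (A, B, C) +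
      ((ℓ * (a * j + b * ℓ) - k * (c * j + d * ℓ) : ℤ) : ℂ) =
      heegnerTau (A, B, C) * ((c : ℤ) * heegnerTau (A, B, C) + ((c * j + d * ℓ : ℤ) : ℂ)) := by
    rw [← hτ]
    push_cast
    linear_combination (ℓ : ℂ) ^ 2 * hg' - ((ℓ : ℂ) * a - c * ((ℓ : ℂ) * zk)) * hzj' +
      (c * (τ + j) + d * ℓ) * hzk'
  obtain ⟨t, h1, h2, h3⟩ := exists_eq_mul_of_moebius_fix hA hD hprim key
  -- `ℓ ∣ t`, else `ℓ ∣ C_j`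
  have hℓt : (ℓ : ℤ) ∣ t := by
    by_contra hℓt
    have e1 : (ℓ : ℤ) ∣ t * (B - A * (j + k)) :=
      ⟨d - a, by linear_combination -h2 + (j + k) * h1⟩
    have e2 : (ℓ : ℤ) ∣ t * (A * j * k - C) :=
      ⟨a * j + b * ℓ - k * d, by linear_combination -h3 - (k * j) * h1⟩
    have e1' := (hℓp.dvd_or_dvd e1).resolve_left hℓt
    have e2' := (hℓp.dvd_or_dvd e2).resolve_left hℓt
    refine not_dvd_third_of_inert hdisc hin j ?_
    have : A * j ^ 2 - B * j + C = -(j * (B - A * (j + k))) - (A * j * k - C) := by ring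
    rw [this]
    exact dvd_sub (dvd_neg.mpr (e1'.mul_left j)) e2'
  obtain ⟨t₁, rfl⟩ := hℓt
  -- norm identity `p (p + tB) + t² AC = ℓ²`, `p = ℓ a - k c = ℓ (a - k t₁ A)`
  have hnorm : (a - k * t₁ * A) * ((a - k * t₁ * A) + t₁ * B) + t₁ ^ 2 * A * C = 1 := by
    have hℓ0 : ((ℓ : ℤ)) ^ 2 ≠ 0 := pow_ne_zero 2 (by exact_mod_cast hℓ.ne_zero)
    apply mul_left_cancel₀ hℓ0
    linear_combination (c : ℤ) * h3 - (ℓ * a - k * c) * h2 + (ℓ : ℤ) ^ 2 * hdet +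
      (k * (2 * (ℓ * a - k * c) + ℓ * t₁ * B + k * (c - ℓ * t₁ * A)) - ℓ * t₁ * C) * h1
  have ht₁ : t₁ = 0 := eq_zero_of_norm_eq_one (by linarith) hnorm
  subst ht₁
  simp only [mul_zero, zero_mul, neg_zero] at h1 h2 h3
  -- `t = 0`: `c = 0`, `a = d = ±1`, `a (j - k) = -b ℓ`
  have had : d = a := by
    have hℓ0 : (ℓ : ℤ) ≠ 0 := by exact_mod_cast hℓ.ne_zero
    apply mul_left_cancel₀ hℓ0
    linear_combination h2 - (j + k) * h1
  rw [had, h1, mul_zero, sub_zero] at hdet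
  apply hjk
  refine ⟨-(a * b), ?_⟩
  have hℓ0 : (ℓ : ℤ) ≠ 0 := by exact_mod_cast hℓ.ne_zero
  have h3' : a * j + b * ℓ - k * a = 0 := by
    apply mul_left_cancel₀ hℓ0
    linear_combination h3 + (k * j) * h1 + (k * ℓ) * had
  linear_combination -(j - k) * hdet + a * h3'

/-- **A translate and the scaled form are `SL₂(ℤ)`-inequivalent:** for a Heegner form
`(A, B, C)` of discriminant `D < −4` and a prime `ℓ` inert for `D`, no `g ∈ SL₂(ℤ)` maps
`τ_{Q_j} = (τ_Q + j)/ℓ` to `τ_{Q_∞} = ℓ τ_Q` (the sublattices `ℤℓ + ℤ(τ_Q + j)` and `ℤ + ℤℓτ_Q` of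
`ℤ + ℤτ_Q` are not homothetic). [cite: GrossLMS1991, §3 Prop. 3.7 (proof)] -/
theorem sl2_smul_heegnerTau_translate_ne_scale (hQ : (A, B, C) ∈ heegnerForms N D)
    (hD4 : D < -4) (hℓ : ℓ.Prime) (hin : ∀ x : ℤ, ¬ (4 * (ℓ : ℤ) ∣ x ^ 2 - D)) (j : ℤ)
    (g : SL(2, ℤ)) :
    g • heegnerTau (A * (ℓ : ℤ) ^ 2, (ℓ : ℤ) * (B - 2 * A * j), A * j ^ 2 - B * j + C) ≠
      heegnerTau (A, (ℓ : ℤ) * B, (ℓ : ℤ) ^ 2 * C) := by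
  simp only [heegnerForms, Set.mem_setOf_eq] at hQ
  obtain ⟨hdisc, hA, -, hprim⟩ := hQ
  have hD : B ^ 2 - 4 * A * C < 0 := by linarith
  have hℓp : Prime (ℓ : ℤ) := Int.prime_iff_natAbs_prime.mpr (by simpa using hℓ)
  have hℓ0 : (ℓ : ℤ) ≠ 0 := by exact_mod_cast hℓ.ne_zero
  haveI : NeZero ℓ := ⟨hℓ.ne_zero⟩
  intro hg
  rw [heegnerTau_translate hA hD j, heegnerTau_scale hA hD] at hg
  set a : ℤ := g 0 0 with ha
  set b : ℤ := g 0 1 with hb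
  set c : ℤ := g 1 0 with hc
  set d : ℤ := g 1 1 with hd
  have hdet : a * d - b * c = 1 := by
    have h := Matrix.det_fin_two (g : Matrix (Fin 2) (Fin 2) ℤ)
    rw [g.det_coe] at h
    exact h.symm
  set τ : ℂ := (heegnerTau (A, B, C) : ℂ) with hτ
  set zj : ℂ := ((tpB ℓ j • heegnerTau (A, B, C) : ℍ) : ℂ) with hzj
  have hℓC : (ℓ : ℂ) ≠ 0 := by exact_mod_cast hℓ.ne_zero
  have hzj' : (ℓ : ℂ) * zj = τ + j := by rw [hzj, coe_tpB_smul, ← hτ]; field_simp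
  have hden : (c : ℂ) * zj + d ≠ 0 := sl2z_denom_ne_zero g _
  have hg' : (a : ℂ) * zj + b = (ℓ : ℂ) * τ * ((c : ℂ) * zj + d) := by
    have h := congrArg (fun z : ℍ ↦ (z : ℂ)) hg
    simp only [coe_specialLinearGroup_apply, eq_intCast, Complex.ofReal_intCast] at h
    rw [coe_tpD_smul, ← hτ, div_eq_iff hden] at h
    exact h
  -- the integral relation `p τ + q = τ (r τ + s)`, `p = a`, `q = aj + bℓ`, `r = ℓc`,
  -- `s = ℓ(cj + dℓ)`
  have key : ((a : ℤ) : ℂ) * heegnerTau (A, B, C) + ((a * j + b * ℓ : ℤ) : ℂ) =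
      heegnerTau (A, B, C) * (((ℓ * c : ℤ) : ℂ) * heegnerTau (A, B, C) +
        ((ℓ * (c * j + d * ℓ) : ℤ) : ℂ)) := by
    rw [← hτ]
    push_cast
    linear_combination (ℓ : ℂ) * hg' - ((a : ℂ) - (ℓ : ℂ) * τ * c) * hzj'
  obtain ⟨t, h1, h2, h3⟩ := exists_eq_mul_of_moebius_fix hA hD hprim key
  -- `ℓ ∣ t`, else `ℓ ∣ A`
  have hℓt : (ℓ : ℤ) ∣ t := by
    by_contra hℓt
    have e1 : (ℓ : ℤ) ∣ t * A := ⟨c, by linear_combination -h1⟩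
    exact not_dvd_fst_of_inert hdisc hin ((hℓp.dvd_or_dvd e1).resolve_left hℓt)
  obtain ⟨t₁, rfl⟩ := hℓt
  have hc' : c = t₁ * A := mul_left_cancel₀ hℓ0 (by linear_combination h1)
  have hb' : (c * j + d * ℓ - t₁ * B) * j + b + t₁ * C = 0 :=
    mul_left_cancel₀ hℓ0 (by linear_combination h3 + j * h2)
  -- norm identity `a₁ (a₁ + t₁ B) + t₁² AC = ad - bc = 1`, `a = ℓ a₁`, `a₁ = cj + dℓ - t₁ B`
  have hnorm : (c * j + d * ℓ - t₁ * B) * ((c * j + d * ℓ - t₁ * B) + t₁ * B) +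
      t₁ ^ 2 * A * C = 1 := by
    linear_combination hdet + t₁ * A * hb' + ((c * j + d * ℓ - t₁ * B) * j + b) * hc' + d * h2
  have ht₁ : t₁ = 0 := eq_zero_of_norm_eq_one (by linarith) hnorm
  subst ht₁
  simp only [mul_zero, zero_mul] at hc' h2
  -- `t = 0`: `c = 0`, `a = ℓ² d`, `ad = 1`: impossible
  have h1' : (ℓ : ℤ) ∣ 1 := ⟨ℓ * d ^ 2, by linear_combination -hdet - d * h2 + (d * ℓ * j - b) * hc'⟩
  exact hℓp.not_dvd_one h1'

/-! ### The `ℓ + 1` neighbour forms are pairwise `Γ₀(N)`-inequivalent -/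

/-- **`Q_j ∼ Q_{j+ℓ}` under `Γ₀(N)`:** `τ_{Q_{j+ℓ}} = τ_{Q_j} + 1 = T • τ_{Q_j}` with
`T ∈ Γ₀(N)` (the tree's `T_zpow_smul_heegnerTau`, `T_mem_Gamma0`), so the class of the translate
`Q_j` depends only on `j mod ℓ`: with the inequivalences below, the `T_ℓ`-neighbours of `τ_Q`
are exactly `ℓ + 1` points of `Y₀(N)`. [folklore] -/
theorem isGamma0Equiv_translate_translate_add (hA : 0 < A) (hD : B ^ 2 - 4 * A * C < 0)
    (hℓ : ℓ ≠ 0) (j : ℤ) :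
    IsGamma0Equiv N (A * (ℓ : ℤ) ^ 2, (ℓ : ℤ) * (B - 2 * A * j), A * j ^ 2 - B * j + C)
      (A * (ℓ : ℤ) ^ 2, (ℓ : ℤ) * (B - 2 * A * (j + ℓ)),
        A * (j + ℓ) ^ 2 - B * (j + ℓ) + C) := by
  refine ⟨⟨ModularGroup.T, T_mem_Gamma0 N⟩, ?_⟩
  have hℓ0 : (0 : ℤ) < ℓ := by exact_mod_cast Nat.pos_of_ne_zero hℓ
  have hA' : 0 < A * (ℓ : ℤ) ^ 2 := mul_pos hA (pow_pos hℓ0 2)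
  have hD' : ((ℓ : ℤ) * (B - 2 * A * j)) ^ 2 - 4 * (A * (ℓ : ℤ) ^ 2) * (A * j ^ 2 - B * j + C)
      < 0 := by
    rw [disc_translate]
    exact mul_neg_of_pos_of_neg (pow_pos hℓ0 2) hD
  change ModularGroup.T •
      heegnerTau (A * (ℓ : ℤ) ^ 2, (ℓ : ℤ) * (B - 2 * A * j), A * j ^ 2 - B * j + C) = _
  have h := T_zpow_smul_heegnerTau 1 hA' hD'
  rw [zpow_one] at h
  rw [h]
  congr 1
  simp only [Prod.mk.injEq]
  exact ⟨trivial, by ring, by ring⟩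


/-- **`Q_j ≁ Q_k` under `Γ₀(N)` for `ℓ ∤ j − k`** (`D < −4`, `ℓ` inert for `D`): the translates
define distinct points of `Y₀(N)` (`IsGamma0Equiv N`). [cite: GrossLMS1991, §3 Prop. 3.7 (proof)] -/
theorem not_isGamma0Equiv_translate_translate (hQ : (A, B, C) ∈ heegnerForms N D)
    (hD4 : D < -4) (hℓ : ℓ.Prime) (hin : ∀ x : ℤ, ¬ (4 * (ℓ : ℤ) ∣ x ^ 2 - D)) {j k : ℤ}
    (hjk : ¬ ((ℓ : ℤ) ∣ j - k)) :
    ¬ IsGamma0Equiv N (A * (ℓ : ℤ) ^ 2, (ℓ : ℤ) * (B - 2 * A * j), A * j ^ 2 - B * j + C)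
      (A * (ℓ : ℤ) ^ 2, (ℓ : ℤ) * (B - 2 * A * k), A * k ^ 2 - B * k + C) := by
  rintro ⟨γ, hγ⟩
  exact sl2_smul_heegnerTau_translate_ne_translate hQ hD4 hℓ hin hjk (γ : SL(2, ℤ)) hγ

/-- **`Q_j ≁ Q_∞` under `Γ₀(N)`** (`D < −4`, `ℓ` inert for `D`). [cite: GrossLMS1991, §3 Prop. 3.7 (proof)] -/
theorem not_isGamma0Equiv_translate_scale (hQ : (A, B, C) ∈ heegnerForms N D)
    (hD4 : D < -4) (hℓ : ℓ.Prime) (hin : ∀ x : ℤ, ¬ (4 * (ℓ : ℤ) ∣ x ^ 2 - D)) (j : ℤ) :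
    ¬ IsGamma0Equiv N (A * (ℓ : ℤ) ^ 2, (ℓ : ℤ) * (B - 2 * A * j), A * j ^ 2 - B * j + C)
      (A, (ℓ : ℤ) * B, (ℓ : ℤ) ^ 2 * C) := by
  rintro ⟨γ, hγ⟩
  exact sl2_smul_heegnerTau_translate_ne_scale hQ hD4 hℓ hin j (γ : SL(2, ℤ)) hγ

/-- **`Q_∞ ≁ Q_j` under `Γ₀(N)`** (`D < −4`, `ℓ` inert for `D`; the previous statement for
`γ⁻¹`). [cite: GrossLMS1991, §3 Prop. 3.7 (proof)] -/
theorem not_isGamma0Equiv_scale_translate (hQ : (A, B, C) ∈ heegnerForms N D)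
    (hD4 : D < -4) (hℓ : ℓ.Prime) (hin : ∀ x : ℤ, ¬ (4 * (ℓ : ℤ) ∣ x ^ 2 - D)) (j : ℤ) :
    ¬ IsGamma0Equiv N (A, (ℓ : ℤ) * B, (ℓ : ℤ) ^ 2 * C)
      (A * (ℓ : ℤ) ^ 2, (ℓ : ℤ) * (B - 2 * A * j), A * j ^ 2 - B * j + C) := by
  rintro ⟨γ, hγ⟩
  refine not_isGamma0Equiv_translate_scale hQ hD4 hℓ hin j ⟨γ⁻¹, ?_⟩
  rw [← hγ, inv_smul_smul]

end Summit.BirchSwinnertonDyer.Rank1Residual.X11b.HeegnerHecke
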